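import Literature.Probability.LatticeModels.CorrelationInequalities
import Literature.Probability.LatticeModels.RandomCurrentsProofs
import Literature.Probability.LatticeModels.LebowitzInequality
import HarnessLib

/-!
# Critical Ising family (`crit-ising.S21`): the random-current facts of `CorrelationInequalities`, proved

Companion ("Proofs") file of `Literature/Probability/LatticeModels/CorrelationInequalities.lean`.
That (review-gated) statement file records the three **crit-ising.S21** results on the
random-current representation of the free-boundary, zero-field Ising model on a finite graph `G`
as NAMED FACTS (D-0014):

* `switching_lemma_pair` — the switching lemma for a pair of sources
  `∑_{∂n₁ = {x}∆{y}, ∂n₂ = {x}∆{y}} F(n₁+n₂) w_β(n₁) w_β(n₂)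
     = ∑_{∂n₁ = ∅, ∂n₂ = ∅} F(n₁+n₂) w_β(n₁) w_β(n₂) 1{x ⟷ y in n₁+n₂}`
  (Griffiths–Hurst–Sherman 1970; Aizenman 1982, Lemma 3.2; Duminil-Copin, *Random currents
  expansion of the Ising model*, arXiv:1607.06933, Lemma 2.2 — numbered Lemma 3.1 ("Switching
  lemma", `A, B ⊂ Λ`, any `F`) in the published EMS version, 2018);
* `isingCorr_eq_currentSum_ratio` — `⟨σ_A⟩^∅_{G;β,0} = ∑_{∂n = A} w_β(n) / ∑_{∂n = ∅} w_β(n)`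
  (Duminil-Copin 2016, eq. (2.2));
* `twoPoint_sq_eq_doubleCurrent_conn` — `⟨σ_x σ_y⟩² = P^∅ ⊗ P^∅[x ⟷ y in n₁ + n₂]`, `β ≥ 0`
  (Aizenman 1982, Prop. 3.1; Duminil-Copin 2016, Cor. 2.3).

All three are **discharged** here (`…_holds`), with no new definition and no new named fact, from
the sibling proof file `Literature.Probability.LatticeModels.RandomCurrentsProofs`, which proves the
general two-source switching lemma `currentSum_switching_holds`
(`∂n₁ = A, ∂n₂ = {x}∆{y} ⟶ ∂n₁ = A ∆ {x} ∆ {y}, ∂n₂ = ∅`, every real `β`, bounded `F`; printed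
proof of Duminil-Copin 2016, Lemma 2.2: change of variables `(n₁+n₂, n₁)`, binomial
multiplicities, and the involution `N ↦ N ∆ K` on labelled sub-currents), the representation
`isingCorr_free_eq_currentSum_div_holds` and `isingTwoPoint_free_sq_eq_holds`:

* `switching_lemma_pair_holds` is the specialisation `A := {x} ∆ {y}` of
  `currentSum_switching_holds`, using `({x} ∆ {y}) ∆ ({x} ∆ {y}) = ∅` (`symmDiff_self`); the
  diagonal `x = y` needs no separate treatment (`{x} ∆ {x} = ∅` on both sides and the connection
  indicator is `1`).
* `isingCorr_eq_currentSum_ratio_holds` and `twoPoint_sq_eq_doubleCurrent_conn_holds` are the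
  prelude results verbatim (the statement file restates them under the `crit-ising.S21` names).

## References

* R. B. Griffiths, C. A. Hurst, S. Sherman, *Concavity of magnetization of an Ising ferromagnet
  in a positive external field*, J. Math. Phys. 11 (1970) 790–795.
* M. Aizenman, *Geometric analysis of φ⁴ fields and Ising models*, Comm. Math. Phys. 86 (1982)
  1–48, Lemma 3.2, Prop. 3.1.
* H. Duminil-Copin, *Random currents expansion of the Ising model*, arXiv:1607.06933 (2016), §2,
  eq. (2.2), Lemma 2.2, Cor. 2.3 (published: in *European Congress of Mathematics, Berlin 2016*,
  EMS 2018, 869–889, doi:10.4171/176-1/39, where the switching lemma is Lemma 3.1).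
-/

noncomputable section

open MeasureTheory Finset
open scoped symmDiff

namespace Literature.Probability.LatticeModels

section RandomCurrents

variable {V : Type*} [Fintype V] [DecidableEq V] (G : SimpleGraph V) [DecidableRel G.Adj]

/-- **Discharge of `switching_lemma_pair`** (switching lemma for a pair of sources;
Griffiths–Hurst–Sherman, J. Math. Phys. 11 (1970) 790; Aizenman, Comm. Math. Phys. 86 (1982),
Lemma 3.2; Duminil-Copin 2016, Lemma 2.2 = Lemma 3.1 of the 2018 EMS version).
For all vertices `x, y` of the finite graph `G`, every real `β` and every bounded `F` on currents,
`∑_{∂n₁ = {x}∆{y}, ∂n₂ = {x}∆{y}} F(n₁+n₂) w_β(n₁) w_β(n₂)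
  = ∑_{∂n₁ = ∅, ∂n₂ = ∅} F(n₁+n₂) w_β(n₁) w_β(n₂) 1{x ⟷ y in n₁+n₂}`.
Proof: the case `A := {x} ∆ {y}` of the general switching lemma `currentSum_switching_holds`
(sources `A ∆ ({x} ∆ {y}) = ∅` by `symmDiff_self`). [cite: DuminilCopin2016, Lemma 2.2] [cite: GriffithsHurstSherman1970] -/
theorem switching_lemma_pair_holds : switching_lemma_pair G := by
  intro β x y F hF
  have h := currentSum_switching_holds G β ({x} ∆ {y}) x y F hF
  rwa [symmDiff_self, Finset.bot_eq_empty] at h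

/-- **Discharge of `isingCorr_eq_currentSum_ratio`** (random-current representation of
correlations; Griffiths–Hurst–Sherman 1970; Aizenman 1982, §2; Duminil-Copin 2016, eq. (2.2)).
For the free-boundary, zero-field Ising model on the finite graph `G` and every `A ⊆ V`,
`⟨σ_A⟩^∅_{G;β,0} = ∑_{∂n = A} w_β(n) / ∑_{∂n = ∅} w_β(n)`; this is the prelude result
`isingCorr_free_eq_currentSum_div_holds` verbatim. [cite: DuminilCopin2016, eq. (2.2)] -/
theorem isingCorr_eq_currentSum_ratio_holds : isingCorr_eq_currentSum_ratio G := by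
  intro β A
  exact isingCorr_free_eq_currentSum_div_holds G β A

/-- **Discharge of `twoPoint_sq_eq_doubleCurrent_conn`** (Aizenman, Comm. Math. Phys. 86 (1982),
Prop. 3.1; Duminil-Copin 2016, Corollary 2.3 = Proposition 3.3 of the 2018 EMS version).
For the free-boundary, zero-field Ising model on the finite graph `G` at `β ≥ 0`,
`⟨σ_x σ_y⟩^∅_{G;β,0}² = P^∅ ⊗ P^∅[x ⟷ y in n₁ + n₂]`; this is the prelude result
`isingTwoPoint_free_sq_eq_holds` verbatim. [cite: DuminilCopin2016, Corollary 2.3] -/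
theorem twoPoint_sq_eq_doubleCurrent_conn_holds : twoPoint_sq_eq_doubleCurrent_conn G := by
  intro β hβ x y
  exact isingTwoPoint_free_sq_eq_holds G hβ x y

end RandomCurrents

end Literature.Probability.LatticeModels

/-!
# Appendix (crit-ising.S19): Lebowitz' inequality `U₄ ≤ 0` — discharge of `lebowitz`

This second part of the proofs file (literature-prover, 2026-08-15) **discharges** the named
fact `Literature.Probability.LatticeModels.lebowitz` (crit-ising.S19; Lebowitz, Comm. Math. Phys.
35 (1974) 87; Glimm–Jaffe, *Quantum Physics*, 2nd ed. (1987), §4.3,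
Cor. 4.3.3 and the Remark after Cor. 4.3.4: "For even `ν` and all `hᵢ = 0`, we have …
`U(i₁,i₂,i₃,i₄) ≤ 0` (a special case of Corollary 4.3.3)"): for the ferromagnetic
nearest-neighbour Ising model in a finite volume `Λ` of a locally finite graph `G`, with free
boundary condition, zero field and `β ≥ 0`, and all `x₁, …, x₄ ∈ Λ`,

`U₄(x₁,x₂,x₃,x₄) = ⟨σ₁σ₂σ₃σ₄⟩ - ⟨σ₁σ₂⟩⟨σ₃σ₄⟩ - ⟨σ₁σ₃⟩⟨σ₂σ₄⟩ - ⟨σ₁σ₄⟩⟨σ₂σ₃⟩ ≤ 0`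

(`lebowitz_holds`). The proof cannot live in `CorrelationInequalities.lean` itself: it uses
`GKSInequalities` / `LebowitzInequality`, which import `CorrelationInequalities` (hence the extra
import `LebowitzInequality` of this proofs file).

## Proof (Glimm–Jaffe 1987, §4.3: Thm. 4.3.1 ⟹ Cor. 4.3.2 ⟹ Cor. 4.3.3)

Everything happens in the spin system `ν_{Λ;K}` of `GKSInequalities` (Friedli–Velenik 2017,
§3.8.1) with nonnegative couplings on supports of at most two sites, to which the finite-volume
Ising model with free boundary condition belongs (`isingTwoPoint_eq_gksExpect`,
`card_isingSupp_le_two` of `LebowitzInequality`). Write `Z⟨·⟩` for the unnormalised expectation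
`gksSum`, `T_u = ξ_u + χ_u`, `Q_u = ξ_u - χ_u` for the duplicated variables (`tVar2`, `qVar2`) and
`S(u,v;p,r) = ∑∑ T_uT_vQ_pQ_r w(ξ)w(χ)` (`gksSum2`).

1. `gksSum_spinAt_eq_zero_of_even_supp` — at zero field (every term with a nonzero coupling has a
   support of even cardinality) the odd moment `Z⟨σ_u⟩` vanishes, by the global spin flip
   `σ ↦ -σ` (Glimm–Jaffe 1987, proof of Cor. 4.3.3: "`⟨ξ^{B₂}⟩ = 0`, because the expectation is
   invariant under the symmetry `ξ → -ξ`").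
2. Hence (`gksSum2_tVar2_mul`, `gksSum2_qVar2_mul` of `LebowitzInequality`)
   `∑∑ T_uT_v ww = 2 Z·Z⟨σ_uσ_v⟩` and `∑∑ Q_pQ_r ww = 2 Z·Z⟨σ_pσ_r⟩`, and Lebowitz' inequality
   `⟨T_uT_v Q_pQ_r⟩ ≤ ⟨T_uT_v⟩⟨Q_pQ_r⟩` (`lebowitz_pair`, Glimm–Jaffe 1987, Cor. 4.3.2, third
   inequality) reads `S(u,v;p,r) ≤ 4 (Z⟨σ_uσ_v⟩)(Z⟨σ_pσ_r⟩)` (`gksSum2_ttqq_le_of_even`).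
3. The covariance identity `cov_spinPair_eq_gksSum2` of `LebowitzInequality`
   (Glimm–Jaffe 1987, (4.1.11) in the variables `t, q`),
   `Z·Z⟨σ_aσ_zσ_xσ_y⟩ - Z⟨σ_aσ_z⟩Z⟨σ_xσ_y⟩ = ⅛ (S(z,y;a,x) + S(z,x;a,y) + S(a,y;z,x) + S(a,x;z,y))`,
   and step 2 give
   `Z·Z⟨σ_aσ_zσ_xσ_y⟩ - Z⟨σ_aσ_z⟩Z⟨σ_xσ_y⟩ ≤ Z⟨σ_aσ_x⟩Z⟨σ_zσ_y⟩ + Z⟨σ_aσ_y⟩Z⟨σ_zσ_x⟩`, i.e.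
   `Z² U₄(a,z,x,y) ≤ 0` (`gksSum_ursellFour_le`); dividing by `Z² > 0` gives `U₄ ≤ 0` for
   `ν_{Λ;K}` (`gksExpect_connectedFour_nonpos`). This is exactly the bookkeeping of the printed
   proof of Cor. 4.3.3 for `A = {a,z}`, `B = {x,y}` (expand `2^{(|A|+|B|)/2}⟨t^Aq^B⟩ ≤
   2^{(|A|+|B|)/2}⟨t^A⟩⟨q^B⟩` and drop the odd moments).
4. `lebowitz_holds` — transfer to `isingMeasure G Λ β 0 .free` (`isingTwoPoint_eq_gksExpect`,
   `nPoint_isingMeasure_four_eq_gksExpect`, `gksCoupling_free_zero_eq_zero_or_even`) and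
   unfold `connectedFour` / `twoPoint`.

## Faithfulness notes

* Glimm–Jaffe state Thm. 4.3.1 / Cor. 4.3.3 for `φ⁴`-type single-spin measures ("the general case
  follows by limits"); the spin-`½` case is Lebowitz' original setting (Lebowitz 1974) and is the
  one proved in `LebowitzInequality` (`sum_repMonomial_nonneg`), on which this file rests.
* No hypothesis beyond those of the fact is used: `β ≥ 0`, free boundary condition, `h = 0`, the
  four sites in `Λ` (for sites outside `Λ` the free-boundary spins are frozen and `U₄ = 0`).
* An independent route to the same inequality is the random-current identity
  `U₄ = -2⟨σσ⟩⟨σσ⟩·P[x ⟷ z]` (`UrsellFourCurrentsProofs.connectedFour_isingMeasure_free_nonpos`,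
  finite graphs with `Λ = univ`); it is not used here.

## Relation to the tree

The same zero-field bookkeeping (steps 1–3) was carried out independently, in the pair form
`⟨σ_aσ_zσ_xσ_y⟩ - ⟨σ_aσ_z⟩⟨σ_xσ_y⟩ ≤ ⟨σ_aσ_x⟩⟨σ_yσ_z⟩ + ⟨σ_aσ_y⟩⟨σ_xσ_z⟩`, inside the barrier
file `Literature.Barriers.CriticalPhenomena.LaceExpansionIsingAboveFourProofs`
(`isingExpect_cov_spinPair_le`, on top of `MeanFieldBoundGHS`, `PlusStateFKG`, `IsingTransport`,
…). That file is not imported: the discharge of a `Probability/LatticeModels` fact should not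
depend on a summit's barrier catalogue, and its import cone is two orders of magnitude larger
than `LebowitzInequality`, which is all that is needed. The helper identities with counterparts in
heavier files are flagged in their docstrings (`gksSum_spinAt_eq_zero_of_even_supp`,
`nPoint_isingMeasure_four_eq_gksExpect`).

## Mathlib status

Mathlib has no Ising model and no correlation inequalities (searched `Lebowitz`, `Ursell`,
`Griffiths`, `Ising`). Anchors: `Fintype.sum_bijective`, `neg_involutive`, `Fin.prod_univ_four`,
`div_le_iff₀`, `Finset.card_pair`, `Sym2.ind`; tree anchors listed above.

## References

* J. L. Lebowitz, *GHS and other inequalities*, Comm. Math. Phys. 35 (1974) 87–92, Theorem,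
  eq. (2.5b) [Lebowitz1974].
* J. Glimm, A. Jaffe, *Quantum Physics: A Functional Integral Point of View*, 2nd ed., Springer
  (1987), §4.3: Thm. 4.3.1, Cor. 4.3.2, Cor. 4.3.3, Remark after Cor. 4.3.4 [GlimmJaffe1987].
* S. Friedli, Y. Velenik, *Statistical Mechanics of Lattice Systems*, CUP (2017), §3.8.1 (the
  spin system `ν_{Λ;K}`), §1.4.3 (invariance under the global spin flip at `h = 0`)
  [FriedliVelenik2017].
-/

namespace Literature.Probability.LatticeModels

/-! ### Zero-field consequences in the spin system `ν_{Λ;K}` -/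

section GKS

variable {Λ : Type*} [Fintype Λ] [DecidableEq Λ] {ι : Type*}
variable (s : Finset ι) (K : ι → ℝ) (C : ι → Finset Λ)

/-- **Odd moments vanish at zero field**: if every interaction term with a nonzero coupling is
supported on an even number of sites, then `Z⟨σ_u⟩ = ∑_σ σ_u e^{∑ᵢ Kᵢ σ_{Cᵢ}} = 0`, because the
weight is invariant and `σ_u` is odd under the global spin flip `σ ↦ -σ` (Glimm–Jaffe 1987, proof
of Cor. 4.3.3: "`⟨ξ^{B₂}⟩ = 0`, because the expectation is invariant under the symmetry
`ξ → -ξ`"; Friedli–Velenik 2017, §1.4.3, invariance under the global spin flip at `h = 0`).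
The same statement, proved with `flipOn univ`, is `gksSum_spinAt_eq_zero_of_even` of
`MeanFieldBoundGHS` (not imported, to keep this part on top of `LebowitzInequality` only). [cite: GlimmJaffe1987, proof of Cor. 4.3.3] -/
theorem gksSum_spinAt_eq_zero_of_even_supp (heven : ∀ i ∈ s, K i = 0 ∨ Even (C i).card)
    (u : Λ) : gksSum s K C (fun σ => spinAt u σ) = 0 := by
  have hw : ∀ σ : SpinConfig Λ, gksWeight s K C (-σ) = gksWeight s K C σ := by
    intro σ
    simp only [gksWeight, gksHamiltonian]
    congr 1
    refine Finset.sum_congr rfl fun i hi => ?_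
    rw [spinProduct_neg]
    rcases heven i hi with h0 | hev
    · simp [h0]
    · rw [hev.neg_one_pow, one_mul]
  unfold gksSum
  have h : ∑ σ, spinAt u σ * gksWeight s K C σ = ∑ σ, spinAt u (-σ) * gksWeight s K C (-σ) :=
    (Fintype.sum_bijective (Neg.neg : SpinConfig Λ → SpinConfig Λ) neg_bijective _ _
      fun _ => rfl).symm
  have h2 : ∑ σ, spinAt u (-σ) * gksWeight s K C (-σ) = -∑ σ, spinAt u σ * gksWeight s K C σ := by
    rw [← Finset.sum_neg_distrib]
    exact Finset.sum_congr rfl fun σ _ => by rw [spinAt_neg, hw]; ring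
  linarith

/-- At zero field `∑∑ T_uT_v w(ξ)w(χ) = 2 (Z⟨σ_uσ_v⟩) Z` (the cross terms `(Z⟨σ_u⟩)(Z⟨σ_v⟩)` of
`gksSum2_tVar2_mul` vanish). [cite: GlimmJaffe1987, proof of Cor. 4.3.3] -/
theorem gksSum2_tVar2_mul_of_even (heven : ∀ i ∈ s, K i = 0 ∨ Even (C i).card) (u v : Λ) :
    gksSum2 s K C (fun ξ χ => tVar2 u ξ χ * tVar2 v ξ χ) =
      2 * (gksSum s K C (spinPair u v) * gksSum s K C (fun _ => 1)) := by
  rw [gksSum2_tVar2_mul, gksSum_spinAt_eq_zero_of_even_supp s K C heven u]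
  ring

/-- At zero field `∑∑ Q_pQ_r w(ξ)w(χ) = 2 (Z⟨σ_pσ_r⟩) Z` (the cross terms of `gksSum2_qVar2_mul`
vanish). [cite: GlimmJaffe1987, proof of Cor. 4.3.3] -/
theorem gksSum2_qVar2_mul_of_even (heven : ∀ i ∈ s, K i = 0 ∨ Even (C i).card) (p r : Λ) :
    gksSum2 s K C (fun ξ χ => qVar2 p ξ χ * qVar2 r ξ χ) =
      2 * (gksSum s K C (spinPair p r) * gksSum s K C (fun _ => 1)) := by
  rw [gksSum2_qVar2_mul, gksSum_spinAt_eq_zero_of_even_supp s K C heven p]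
  ring

/-- **Lebowitz' inequality at zero field, one term**: for `Kᵢ ≥ 0` on supports of at most two
sites, all of even cardinality where `Kᵢ ≠ 0`,
`∑∑ T_uT_vQ_pQ_r ww ≤ 4 (Z⟨σ_uσ_v⟩)(Z⟨σ_pσ_r⟩)`: this is `⟨T_uT_vQ_pQ_r⟩ ≤ ⟨T_uT_v⟩⟨Q_pQ_r⟩`
(`lebowitz_pair`; Glimm–Jaffe 1987, Cor. 4.3.2, third inequality; Lebowitz 1974, (2.5b)) with
`⟨T_uT_v⟩ = 2⟨σ_uσ_v⟩`, `⟨Q_pQ_r⟩ = 2⟨σ_pσ_r⟩` at zero field. [cite: GlimmJaffe1987, Cor. 4.3.2 and proof of Cor. 4.3.3] -/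
theorem gksSum2_ttqq_le_of_even (hK : ∀ i ∈ s, 0 ≤ K i) (hC : ∀ i ∈ s, (C i).card ≤ 2)
    (heven : ∀ i ∈ s, K i = 0 ∨ Even (C i).card) (u v p r : Λ) :
    gksSum2 s K C (fun ξ χ => tVar2 u ξ χ * tVar2 v ξ χ * (qVar2 p ξ χ * qVar2 r ξ χ)) ≤
      4 * (gksSum s K C (spinPair u v) * gksSum s K C (spinPair p r)) := by
  have hZ := gksSum_one_pos s K C
  have hleb := lebowitz_pair s K C hK hC u v p r
  rw [gksSum2_one, gksSum2_tVar2_mul_of_even s K C heven, gksSum2_qVar2_mul_of_even s K C heven]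
    at hleb
  have h' : gksSum2 s K C (fun ξ χ => tVar2 u ξ χ * tVar2 v ξ χ * (qVar2 p ξ χ * qVar2 r ξ χ)) *
      (gksSum s K C (fun _ => 1) * gksSum s K C (fun _ => 1)) ≤
      4 * (gksSum s K C (spinPair u v) * gksSum s K C (spinPair p r)) *
        (gksSum s K C (fun _ => 1) * gksSum s K C (fun _ => 1)) := by
    calc _ ≤ _ := hleb
      _ = _ := by ring
  exact le_of_mul_le_mul_right h' (mul_pos hZ hZ)

/-- **Lebowitz' inequality `U₄ ≤ 0`, unnormalised, for the spin system `ν_{Λ;K}`** with `Kᵢ ≥ 0`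
on supports of at most two sites, of even cardinality where `Kᵢ ≠ 0` (pair interactions, zero
field): `Z·Z⟨σ_aσ_zσ_xσ_y⟩ - Z⟨σ_aσ_z⟩Z⟨σ_xσ_y⟩ ≤ Z⟨σ_aσ_x⟩Z⟨σ_zσ_y⟩ + Z⟨σ_aσ_y⟩Z⟨σ_zσ_x⟩`.
Proof: the covariance identity `cov_spinPair_eq_gksSum2` and four instances of
`gksSum2_ttqq_le_of_even` (Glimm–Jaffe 1987, proof of Cor. 4.3.3 with `A = {a,z}`,
`B = {x,y}`). [cite: GlimmJaffe1987, Cor. 4.3.3] -/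
theorem gksSum_ursellFour_le (hK : ∀ i ∈ s, 0 ≤ K i) (hC : ∀ i ∈ s, (C i).card ≤ 2)
    (heven : ∀ i ∈ s, K i = 0 ∨ Even (C i).card) (a z x y : Λ) :
    gksSum s K C (fun _ => 1) * gksSum s K C (fun σ => spinPair a z σ * spinPair x y σ) -
        gksSum s K C (spinPair a z) * gksSum s K C (spinPair x y) ≤
      gksSum s K C (spinPair a x) * gksSum s K C (spinPair z y) +
        gksSum s K C (spinPair a y) * gksSum s K C (spinPair z x) := by
  rw [cov_spinPair_eq_gksSum2]
  have h1 := gksSum2_ttqq_le_of_even s K C hK hC heven z y a x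
  have h2 := gksSum2_ttqq_le_of_even s K C hK hC heven z x a y
  have h3 := gksSum2_ttqq_le_of_even s K C hK hC heven a y z x
  have h4 := gksSum2_ttqq_le_of_even s K C hK hC heven a x z y
  linarith [mul_comm (gksSum s K C (spinPair z y)) (gksSum s K C (spinPair a x)),
    mul_comm (gksSum s K C (spinPair z x)) (gksSum s K C (spinPair a y))]

/-- **Lebowitz' inequality `U₄ ≤ 0` for the spin system `ν_{Λ;K}`** with `Kᵢ ≥ 0` on supports of
at most two sites, of even cardinality where `Kᵢ ≠ 0` (pair interactions, zero field):
`⟨σ_aσ_zσ_xσ_y⟩ - ⟨σ_aσ_z⟩⟨σ_xσ_y⟩ - ⟨σ_aσ_x⟩⟨σ_zσ_y⟩ - ⟨σ_aσ_y⟩⟨σ_zσ_x⟩ ≤ 0`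
(Glimm–Jaffe 1987, Cor. 4.3.3 and the Remark after Cor. 4.3.4, `U(i₁,i₂,i₃,i₄) ≤ 0`;
Lebowitz 1974). [cite: GlimmJaffe1987, Cor. 4.3.3] -/
theorem gksExpect_connectedFour_nonpos (hK : ∀ i ∈ s, 0 ≤ K i) (hC : ∀ i ∈ s, (C i).card ≤ 2)
    (heven : ∀ i ∈ s, K i = 0 ∨ Even (C i).card) (a z x y : Λ) :
    gksExpect s K C (fun σ => spinPair a z σ * spinPair x y σ) -
        gksExpect s K C (spinPair a z) * gksExpect s K C (spinPair x y) -
        gksExpect s K C (spinPair a x) * gksExpect s K C (spinPair z y) -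
        gksExpect s K C (spinPair a y) * gksExpect s K C (spinPair z x) ≤ 0 := by
  have hZ := gksSum_one_pos s K C
  set Z := gksSum s K C (fun _ => 1) with hZdef
  have hun := gksSum_ursellFour_le s K C hK hC heven a z x y
  rw [← hZdef] at hun
  simp only [gksExpect, ← hZdef]
  have key : gksSum s K C (fun σ => spinPair a z σ * spinPair x y σ) / Z -
      gksSum s K C (spinPair a z) / Z * (gksSum s K C (spinPair x y) / Z) -
      gksSum s K C (spinPair a x) / Z * (gksSum s K C (spinPair z y) / Z) -
      gksSum s K C (spinPair a y) / Z * (gksSum s K C (spinPair z x) / Z) =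
      (Z * gksSum s K C (fun σ => spinPair a z σ * spinPair x y σ) -
        gksSum s K C (spinPair a z) * gksSum s K C (spinPair x y) -
        gksSum s K C (spinPair a x) * gksSum s K C (spinPair z y) -
        gksSum s K C (spinPair a y) * gksSum s K C (spinPair z x)) / (Z * Z) := by
    field_simp
  rw [key, div_le_iff₀ (mul_pos hZ hZ), zero_mul]
  linarith

end GKS

/-! ### The finite-volume Ising model with free boundary condition at zero field -/

section Ising

open MeasureTheory

variable {V : Type*} (G : SimpleGraph V) [DecidableEq V] [G.LocallyFinite]

/-- **The finite-volume four-point function in the spin system `ν_{Λ;K}`**: for `x₁, …, x₄ ∈ Λ`,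
`⟨σ_{x₁}σ_{x₂}σ_{x₃}σ_{x₄}⟩^{bc}_{Λ;β,h} = ⟨(σ_{x₁}σ_{x₂})(σ_{x₃}σ_{x₄})⟩_{Λ;K}`, the `4`-point
function `nPoint (isingMeasure …) spinAt x` of `Correlations` written as a `gksExpect` of a
product of two pair observables (the four-point companion of `isingTwoPoint_eq_gksExpect`;
Friedli–Velenik 2017, §3.8.1, p. 141: the finite-volume Gibbs distributions "can all be written
in this form"; for the pair-observable spelling of the left side see
`isingExpect_spinPair_mul_spinPair_eq_gksExpect` of `SusceptibilityMeanFieldBound`, not imported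
here). [cite: FriedliVelenik2017, §3.8.1, p. 141] -/
theorem nPoint_isingMeasure_four_eq_gksExpect (Λ : Finset V) (β h : ℝ)
    (bc : BoundaryCondition V) (x : Fin 4 → V) (hx : ∀ i, x i ∈ Λ) :
    nPoint (isingMeasure G Λ β h bc) spinAt x =
      gksExpect (isingIdx G Λ) (gksCoupling G Λ β h bc) (isingSupp Λ)
        (fun τ => spinPair ⟨x 0, hx 0⟩ ⟨x 1, hx 1⟩ τ * spinPair ⟨x 2, hx 2⟩ ⟨x 3, hx 3⟩ τ) := by
  have hm : Measurable fun σ : SpinConfig V => spinPair (x 0) (x 1) σ * spinPair (x 2) (x 3) σ := by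
    fun_prop
  have h4 : nPoint (isingMeasure G Λ β h bc) spinAt x =
      isingExpect G Λ β h bc (fun σ => spinPair (x 0) (x 1) σ * spinPair (x 2) (x 3) σ) := by
    simp only [nPoint, isingExpect, Fin.prod_univ_four, spinPair, mul_assoc]
  rw [h4, isingExpect, integral_isingMeasure G Λ β h bc hm, gksExpect, gksSum, gksSum,
    isingPartitionFunction]
  congr 1
  · refine Finset.sum_congr rfl fun τ _ => ?_
    rw [isingWeight_eq_gksWeight, spinPair, spinPair, spinAt_glue_of_mem τ bc (hx 0),
      spinAt_glue_of_mem τ bc (hx 1), spinAt_glue_of_mem τ bc (hx 2),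
      spinAt_glue_of_mem τ bc (hx 3), spinPair, spinPair, mul_comm]
  · refine Finset.sum_congr rfl fun τ _ => ?_
    rw [isingWeight_eq_gksWeight, one_mul]

/-- For the free boundary condition at zero field every interaction term of the Ising model with a
nonzero coupling is an edge `{u, v}` inside `Λ`, whose support `{u, v} ⊆ Λ` has two elements (the
field terms have coupling `β·0 = 0`, the edges not inside `Λ` coupling `0`). This is the evenness
behind the spin-flip symmetry at `h = 0` (Friedli–Velenik 2017, §3.8.1, p. 141, and §3.7.1).
[cite: FriedliVelenik2017, §3.8.1, p. 141] -/
theorem gksCoupling_free_zero_eq_zero_or_even (Λ : Finset V) (β : ℝ) :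
    ∀ i ∈ isingIdx G Λ, gksCoupling G Λ β 0 .free i = 0 ∨ Even (isingSupp Λ i).card := by
  rintro (e | w) _
  · by_cases he : e ∈ edgesIn G Λ
    · right
      have he' := mem_edgesIn_iff.1 he
      induction e using Sym2.ind with
      | _ u v =>
        have huv : u ≠ v := G.ne_of_adj ((SimpleGraph.mem_edgeSet G).1 he'.1)
        have hu : u ∈ Λ := he'.2 u (Sym2.mem_mk_left u v)
        have hv : v ∈ Λ := he'.2 v (Sym2.mem_mk_right u v)
        have hset : isingSupp Λ (.inl s(u, v)) = {⟨u, hu⟩, ⟨v, hv⟩} := by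
          ext w
          simp only [isingSupp, Finset.mem_filter, Finset.mem_univ, true_and, Sym2.mem_iff,
            Finset.mem_insert, Finset.mem_singleton, Subtype.ext_iff]
        rw [hset, Finset.card_pair fun h => huv (congrArg Subtype.val h)]
        exact even_two
    · left
      simp [gksCoupling, interactionEdges_free, he]
  · left
    simp [gksCoupling]

variable {β : ℝ}

/-- **Discharge of `Literature.Probability.LatticeModels.lebowitz`** (crit-ising.S19, Lebowitz'
inequality; Lebowitz, Comm. Math. Phys. 35 (1974) 87, Theorem, (2.5b); Glimm–Jaffe 1987, §4.3,
Cor. 4.3.3 and the Remark after Cor. 4.3.4: "for even `ν` and all `hᵢ = 0` … `U(i₁,i₂,i₃,i₄) ≤ 0`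
(a special case of Corollary 4.3.3)"): for the ferromagnetic Ising model in the finite volume `Λ`
of a locally finite graph with free boundary condition, zero field and `β ≥ 0`,
`U₄(x₁,x₂,x₃,x₄) = ⟨σ₁σ₂σ₃σ₄⟩ - ⟨σ₁σ₂⟩⟨σ₃σ₄⟩ - ⟨σ₁σ₃⟩⟨σ₂σ₄⟩ - ⟨σ₁σ₄⟩⟨σ₂σ₃⟩ ≤ 0` for all
`x₁, …, x₄ ∈ Λ`. Proof: `gksExpect_connectedFour_nonpos` (fourfold-replica proof of Glimm–Jaffe,
Thm. 4.3.1 / Cor. 4.3.2, in `LebowitzInequality`, plus the vanishing of odd moments at `h = 0`)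
transported to `isingMeasure G Λ β 0 .free` by `isingTwoPoint_eq_gksExpect` and
`nPoint_isingMeasure_four_eq_gksExpect`. [cite: GlimmJaffe1987, Cor. 4.3.3] [cite: Lebowitz1974, Theorem, eq. (2.5b)] -/
theorem lebowitz_holds : lebowitz G (β := β) := by
  intro hβ Λ x hx
  set s := isingIdx G Λ with hs
  set K := gksCoupling G Λ β 0 .free with hK'
  set C := isingSupp Λ with hC'
  have hK : ∀ i ∈ s, 0 ≤ K i := gksCoupling_nonneg G hβ le_rfl (Or.inl rfl)
  have hC : ∀ i ∈ s, (C i).card ≤ 2 := fun i _ => card_isingSupp_le_two Λ i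
  have heven : ∀ i ∈ s, K i = 0 ∨ Even (C i).card := gksCoupling_free_zero_eq_zero_or_even G Λ β
  have hmain := gksExpect_connectedFour_nonpos s K C hK hC heven
    ⟨x 0, hx 0⟩ ⟨x 1, hx 1⟩ ⟨x 2, hx 2⟩ ⟨x 3, hx 3⟩
  have h2 : ∀ i j, twoPoint (isingMeasure G Λ β 0 .free) spinAt (x i) (x j) =
      gksExpect s K C (spinPair ⟨x i, hx i⟩ ⟨x j, hx j⟩) := fun i j =>
    isingTwoPoint_eq_gksExpect G Λ β 0 .free (hx i) (hx j)
  rw [connectedFour, nPoint_isingMeasure_four_eq_gksExpect G Λ β 0 .free x hx, h2 0 1, h2 2 3,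
    h2 0 2, h2 1 3, h2 0 3, h2 1 2]
  exact hmain

end Ising

end Literature.Probability.LatticeModels
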